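import Summits.CriticalPhenomena.PercolationContinuityZ3.Theorems.PercNearOneGluingNoHeavyLowerTailQuantitativeHpartHarrisFloor
import Summits.CriticalPhenomena.PercolationContinuityZ3.Theorems.PercNearOneGluingNoHeavyLowerTailCSHTheoremOne
import Summits.CriticalPhenomena.PercolationContinuityZ3.Theorems.PercNearOneGluingAdditiveGluingCSHNilFromHpart
import HarnessLib

/-!
# Every CSH margin dominates its world-Harris floor (lane rows M2-R7 / M2-R6: the quantitative conditioned slack hierarchy)
# `cshMargin w x Y D o v f ≥ μ(x↮Y) · ∫_{x↮Y} Cov_{w^ω}(f(𝒞_x), 1{o ↔ {x} ∪ D ∪ {v}}) dμ`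

Support file (`--supports stmt-CriticalPhenomena-4575`), prover seat `prim-rate-mine-2` (lane prim-rate, constants-miner (c), BENCH rows
M2-R7 (level `D = []`) and M2-R6 (all levels)).  No definitions, no named facts, no sorries; standard axioms.

The conditioned slack hierarchy CSH(Y; x; D; o, v) of the θ(p_c)=0 paper (`CSH.cshHolds`: `0 ≤ CSH.cshMargin w x Y D o v f` for monotone
`f`; owner `x`, avoided set `Y`, decoys `D`, observers `o, v`) is proved in the tree by SIGN statements only (Lemma T
`CSH.cshMargin_nonneg_of_within`, Lemma U `CSH.within_nonneg_of_hpart`, Lemma H `CSH.hpart_nonneg`).  THIS FILE makes the whole chain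
quantitative, for EVERY decoy list:

  `μ(D₀) · ∫_{D₀} Cov_{w^ω}(f(𝒞_x), 1_U) dμ ≤ cshMargin w x Y D o v f`,   `D₀ = {x ↮ Y}`, `U = {o ↔ {x} ∪ D} ∪ {o ↔ v}`,
  `w^ω` = the weights zeroed on the pairs meeting the open cluster of `Y` (`CSH.cshMargin_ge_worldHarris`; `D = []`:
  `CSH.cshMargin_nil_ge_worldHarris`, `U = {o↔x} ∪ {o↔v}`).

Assembly: (i) the margin is the LINEAR form `Σ_u Λ_u·cov_{D₀}(f(𝒞_x), 1{x↔u})` (`CSH.cshMarg_eq_sum`), i.e. BHK's `cov_D(f, h)` for the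
multi-marker test function `h = Σ_u Λ_u χ_u` (bookkeeping copied from the private lemmas of `TwoClusterGibbsCovariance`); (ii) the EXACT
one-step decomposition of van den Berg–Häggström–Kahn's Gibbs sampler `cov_D(f,h) = μ(D₀)·R(f,h) + cov_D(𝒯f,h)` (`BHK2006.covD_eq_withinD_add`)
with `cov_D(𝒯f,h) = cshMargin(𝒯f) ≥ 0` by Theorem 1 itself (`CSH.cshHolds`, `𝒯f` monotone by `BHK2006.gibbsT_mono`) — the quantitative
Lemma T; (iii) `R(f,h)` is the within-margin, which the tree's IDENTITY `CSH.within_unfold` splits into the H-part at the marker set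
`{x} ∪ D` plus the decoy combination `subT(o) − p·subT(v) ≥ 0` (`CSH.subT_comb_nonneg`, fed by the lower levels of the hierarchy,
`CSH.cshMargin_nonneg_of_lower_induction`) — the quantitative Lemma U; (iv) the H-part dominates the world-Harris integral by the lane's
`CSH.worldHarris_le_hpart` (K6 with its Harris term kept + (Htw)) — the quantitative Lemma H.  The floor is EXPLICIT (residual-graph
covariances; each ≥ joint pivotalities × `1/|E|` by `QuantHarris.sum_coinfluence_le_card_mul_cov_prodBernoulli`) and it is the term the
lane's (S5) Harris floor (row M2-R6) sums along the peeling.  Lane census (n ≤ 5, 105 084 + 31 248 exact instances): never violated, tight,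
and positive exactly when the margin is.
[cite: VandenbergHaggstromKahn2005, §2.1 pp. 9–13 (Lemmas 2.3–2.4, the chain), Thm. 1.4 (p. 7)] [cite: Gladkov2024, Thm. 3.2 (p. 4)]
-/

noncomputable section

namespace Summit.CriticalPhenomena.PercolationContinuityZ3.Theorems.CSH

open MeasureTheory Set unitInterval
open Literature.Probability.LatticeModels (prodBernoulli prodBernoulli_real_pos_of_nonempty)
open Literature.Probability.Percolation Literature.Probability.Percolation.KNPreFKG
open Literature.Probability.Percolation.BHK2006 (weight integral_prodBernoulli_eq_sum setCl setCl_singleton gibbsT gibbsT_mono withinD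
  condCov condS covD_eq_withinD_add ite_mem_openEdgeCluster_eq_indicator)
open DecisionTree (ind ind_of_mem ind_of_not_mem ind_nonneg)
open scoped Classical

variable {V : Type*} [Fintype V]

/-! ### Bookkeeping copied from `TwoClusterGibbsCovariance` (private there): sums versus integrals -/

omit [Fintype V] in
/-- `D = {s ↮ X}` in the two-set form. [folklore] -/
private theorem mem_D_iff' (s : V) (X : Set V) (ω : BondConfig V) :
    ω ∈ {ω : BondConfig V | ∀ x ∈ X, ¬ (openGraph ω).Reachable s x} ↔
      ∀ s' ∈ ({s} : Set V), ∀ t ∈ X, ¬ (openGraph ω).Reachable s' t := by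
  simp only [Set.mem_setOf_eq, Set.mem_singleton_iff, forall_eq]

/-- Total mass of the product weights is `1`. [folklore] -/
private theorem sum_weight_eq_one' (w : Sym2 V → unitInterval) :
    ∑ ω : Set (Sym2 V), weight (fun e => (w e : ℝ)) ω = 1 := by
  have h1 := integral_prodBernoulli_eq_sum w fun _ => (1 : ℝ)
  simp only [integral_const, probReal_univ, smul_eq_mul, mul_one] at h1
  exact h1.symm

/-- `μ(D)` as a weighted sum. [folklore] -/
private theorem real_D_eq_sum' (w : Sym2 V → unitInterval) (s : V) (X : Set V) :
    (prodBernoulli w).real {ω : BondConfig V | ∀ x ∈ X, ¬ (openGraph ω).Reachable s x} =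
      ∑ ω, weight (fun e => (w e : ℝ)) ω *
        ind {ω : BondConfig V | ∀ x ∈ X, ¬ (openGraph ω).Reachable s x} ω := by
  rw [← integral_indicator_one (MeasurableSet.of_discrete), integral_prodBernoulli_eq_sum]
  refine Finset.sum_congr rfl fun ω _ => ?_
  by_cases hω : ω ∈ {ω : BondConfig V | ∀ x ∈ X, ¬ (openGraph ω).Reachable s x}
  · rw [Set.indicator_of_mem hω, ind_of_mem hω, Pi.one_apply]
  · rw [Set.indicator_of_notMem hω, ind_of_not_mem hω, mul_zero]

/-- `∫_D ψ(C_s) dμ` as a weighted sum. [folklore] -/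
private theorem setIntegral_D_eq_sum' (w : Sym2 V → unitInterval) (s : V) (X : Set V)
    (ψ : Set (Sym2 V) → ℝ) :
    ∫ ω in {ω : BondConfig V | ∀ x ∈ X, ¬ (openGraph ω).Reachable s x}, ψ (openEdgeCluster ω s)
        ∂(prodBernoulli w) =
      ∑ ω, weight (fun e => (w e : ℝ)) ω * (ψ (setCl ω {s}) *
        ind {ω : BondConfig V | ∀ x ∈ X, ¬ (openGraph ω).Reachable s x} ω) := by
  rw [← integral_indicator (MeasurableSet.of_discrete), integral_prodBernoulli_eq_sum]
  refine Finset.sum_congr rfl fun ω _ => ?_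
  rw [setCl_singleton]
  by_cases hω : ω ∈ {ω : BondConfig V | ∀ x ∈ X, ¬ (openGraph ω).Reachable s x}
  · rw [Set.indicator_of_mem hω, ind_of_mem hω, mul_one]
  · simp only [Set.indicator_of_notMem hω, ind_of_not_mem hω, mul_zero]

/-- `∫_D F · 1_A = ∫_{D ∩ A} F`. [folklore] -/
private theorem setIntegral_mul_indicator_one'' (μ : Measure (BondConfig V)) (D A : Set (BondConfig V))
    (F : BondConfig V → ℝ) :
    ∫ ω in D, F ω * A.indicator 1 ω ∂μ = ∫ ω in D ∩ A, F ω ∂μ := by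
  have hA : MeasurableSet A := MeasurableSet.of_discrete
  have e : (fun ω => F ω * A.indicator (1 : BondConfig V → ℝ) ω) = A.indicator F := by
    funext ω
    by_cases hω : ω ∈ A
    · rw [Set.indicator_of_mem hω, Set.indicator_of_mem hω, Pi.one_apply, mul_one]
    · rw [Set.indicator_of_notMem hω, Set.indicator_of_notMem hω, mul_zero]
  rw [e, setIntegral_indicator hA]

/-- `∫ F · 1_A = ∫_A F`. [folklore] -/
private theorem integral_mul_indicator_one'' (μ : Measure (BondConfig V)) (A : Set (BondConfig V))
    (F : BondConfig V → ℝ) :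
    ∫ ω, F ω * A.indicator 1 ω ∂μ = ∫ ω in A, F ω ∂μ := by
  have h := setIntegral_mul_indicator_one'' μ Set.univ A F
  rwa [Measure.restrict_univ, Set.univ_inter] at h

/-- The measure form of BHK's denominator-free conditional covariance `cov_D(φ, h)` of two functions of `𝒞_s`.
[cite: VandenbergHaggstromKahn2005, Thm. 1.5 eq. (9) (p. 7)] -/
private theorem covD_sum_eq (w : Sym2 V → unitInterval) (s : V) (X : Set V) (φ h : Set (Sym2 V) → ℝ) :
    BHK2006.covD (fun e => (w e : ℝ)) {s} {ω : BondConfig V | ∀ x ∈ X, ¬ (openGraph ω).Reachable s x} φ h =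
      (prodBernoulli w).real {ω : BondConfig V | ∀ x ∈ X, ¬ (openGraph ω).Reachable s x} *
          (∫ ω in {ω : BondConfig V | ∀ x ∈ X, ¬ (openGraph ω).Reachable s x},
            φ (openEdgeCluster ω s) * h (openEdgeCluster ω s) ∂(prodBernoulli w)) -
        (∫ ω in {ω : BondConfig V | ∀ x ∈ X, ¬ (openGraph ω).Reachable s x}, φ (openEdgeCluster ω s) ∂(prodBernoulli w)) *
          (∫ ω in {ω : BondConfig V | ∀ x ∈ X, ¬ (openGraph ω).Reachable s x}, h (openEdgeCluster ω s) ∂(prodBernoulli w)) := by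
  rw [BHK2006.covD, real_D_eq_sum' w s X, setIntegral_D_eq_sum' w s X (fun C => φ C * h C),
    setIntegral_D_eq_sum' w s X φ, setIntegral_D_eq_sum' w s X h]

/-- The measure form of BHK's averaged one-step ("within") covariance `R(φ,h)`: the conditional covariance of `φ(𝒞_s)` and `h(𝒞_s)`
given the cluster of `X`, i.e. in the fresh configuration off the pairs meeting `C_X`, integrated over `D = {s ↮ X}`.
[cite: VandenbergHaggstromKahn2005, §2.1 Lemma 2.4 (p. 10)] -/
private theorem withinD_sum_eq (w : Sym2 V → unitInterval) (s : V) (X : Set V) (φ h : Set (Sym2 V) → ℝ) :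
    withinD (fun e => (w e : ℝ)) {s} X {ω : BondConfig V | ∀ x ∈ X, ¬ (openGraph ω).Reachable s x} φ h =
      ∫ ω in {ω : BondConfig V | ∀ x ∈ X, ¬ (openGraph ω).Reachable s x},
        ((∫ η, φ (openEdgeCluster (η \ {e | ∃ v ∈ e, ∃ x ∈ X, (openGraph ω).Reachable x v}) s) *
              h (openEdgeCluster (η \ {e | ∃ v ∈ e, ∃ x ∈ X, (openGraph ω).Reachable x v}) s) ∂(prodBernoulli w)) -
          (∫ η, φ (openEdgeCluster (η \ {e | ∃ v ∈ e, ∃ x ∈ X, (openGraph ω).Reachable x v}) s) ∂(prodBernoulli w)) *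
          (∫ η, h (openEdgeCluster (η \ {e | ∃ v ∈ e, ∃ x ∈ X, (openGraph ω).Reachable x v}) s) ∂(prodBernoulli w)))
        ∂(prodBernoulli w) := by
  rw [withinD, ← integral_indicator (MeasurableSet.of_discrete), integral_prodBernoulli_eq_sum]
  refine Finset.sum_congr rfl fun ω _ => ?_
  by_cases hω : ω ∈ {ω : BondConfig V | ∀ x ∈ X, ¬ (openGraph ω).Reachable s x}
  · rw [Set.indicator_of_mem hω, ind_of_mem hω, mul_one, condCov,
      BHK2006.integral_sdiff_eq_condS w s X (fun A => φ A * h A) ω, BHK2006.integral_sdiff_eq_condS w s X φ ω,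
      BHK2006.integral_sdiff_eq_condS w s X h ω]
  · simp only [Set.indicator_of_notMem hω, ind_of_not_mem hω, mul_zero]

/-- Multi-marker bookkeeping, conclusion side (copy of the private `multiMarker_conclusion_eq`): with `H = Σ_{u∈T} c(u)·χ_u`,
`μ(D)∫_D fH − (∫_D f)(∫_D H) = Σ_{u∈T} c(u)·[μ(D)∫_{D∩{s↔u}} f − (∫_D f) μ(D∩{s↔u})]`. [folklore] -/
private theorem multiMarker_conclusion_eq' (w : Sym2 V → unitInterval) (s : V) (X : Set V) (T : Finset V)
    (c : V → ℝ) (f : Set (Sym2 V) → ℝ) :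
    (prodBernoulli w).real {ω : BondConfig V | ∀ x ∈ X, ¬ (openGraph ω).Reachable s x} *
        (∫ ω in {ω : BondConfig V | ∀ x ∈ X, ¬ (openGraph ω).Reachable s x},
          f (openEdgeCluster ω s) *
            (fun C : Set (Sym2 V) => ∑ u ∈ T, c u * (if (u = s ∨ ∃ e ∈ C, u ∈ e) then (1 : ℝ) else 0))
              (openEdgeCluster ω s) ∂(prodBernoulli w)) -
      (∫ ω in {ω : BondConfig V | ∀ x ∈ X, ¬ (openGraph ω).Reachable s x},
          f (openEdgeCluster ω s) ∂(prodBernoulli w)) *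
        (∫ ω in {ω : BondConfig V | ∀ x ∈ X, ¬ (openGraph ω).Reachable s x},
          (fun C : Set (Sym2 V) => ∑ u ∈ T, c u * (if (u = s ∨ ∃ e ∈ C, u ∈ e) then (1 : ℝ) else 0))
            (openEdgeCluster ω s) ∂(prodBernoulli w)) =
    ∑ u ∈ T, c u * ((prodBernoulli w).real {ω : BondConfig V | ∀ x ∈ X, ¬ (openGraph ω).Reachable s x} *
          (∫ ω in {ω : BondConfig V | ∀ x ∈ X, ¬ (openGraph ω).Reachable s x} ∩ openConn s u,
            f (openEdgeCluster ω s) ∂(prodBernoulli w)) -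
        (∫ ω in {ω : BondConfig V | ∀ x ∈ X, ¬ (openGraph ω).Reachable s x},
            f (openEdgeCluster ω s) ∂(prodBernoulli w)) *
          (prodBernoulli w).real
            ({ω : BondConfig V | ∀ x ∈ X, ¬ (openGraph ω).Reachable s x} ∩ openConn s u)) := by
  set μ := prodBernoulli w with hμ
  set D : Set (BondConfig V) := {ω | ∀ x ∈ X, ¬ (openGraph ω).Reachable s x} with hDdef
  set H : Set (Sym2 V) → ℝ := fun C => ∑ u ∈ T, c u * (if (u = s ∨ ∃ e ∈ C, u ∈ e) then (1 : ℝ) else 0)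
    with hH
  have hHω : ∀ η : BondConfig V, H (openEdgeCluster η s) =
      ∑ u ∈ T, c u * (openConn s u : Set (BondConfig V)).indicator 1 η := fun η => by
    simp only [hH, ite_mem_openEdgeCluster_eq_indicator]
  have split : ∀ G : BondConfig V → ℝ, ∫ ω in D, G ω * H (openEdgeCluster ω s) ∂μ =
      ∑ u ∈ T, c u * (∫ ω in D ∩ openConn s u, G ω ∂μ) := by
    intro G
    have e1 : (fun ω => G ω * H (openEdgeCluster ω s)) = fun ω =>
        ∑ u ∈ T, c u * (G ω * (openConn s u : Set (BondConfig V)).indicator 1 ω) := by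
      funext ω
      rw [hHω, Finset.mul_sum]
      exact Finset.sum_congr rfl fun u _ => by ring
    rw [e1, integral_finsetSum _ fun u _ => Integrable.of_finite]
    exact Finset.sum_congr rfl fun u _ => by rw [integral_const_mul, setIntegral_mul_indicator_one'']
  have massD : ∫ ω in D, H (openEdgeCluster ω s) ∂μ = ∑ u ∈ T, c u * μ.real (D ∩ openConn s u) := by
    have h2 := split (fun _ => (1 : ℝ))
    simp only [one_mul] at h2
    rw [h2]
    exact Finset.sum_congr rfl fun u _ => by rw [setIntegral_const, smul_eq_mul, mul_one]
  rw [split, massD, Finset.mul_sum, Finset.mul_sum, ← Finset.sum_sub_distrib]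
  exact Finset.sum_congr rfl fun u _ => by ring

/-- Multi-marker bookkeeping, fresh-configuration side (copy of the private `multiMarker_fresh_eq`): with `H = Σ_{u∈T} c(u)·χ_u` read on the
edge cluster, `E_η[(gH)(C_s(η∖A_X ω))] − E_η[g]E_η[H] = Σ_{u∈T} c(u)·[∫_{s↔u} g dμ_{w^ω} − (∫ g dμ_{w^ω}) μ_{w^ω}(s↔u)]`, `w^ω` the weights
zeroed on the pairs meeting the cluster of `X`. [cite: VandenbergHaggstromKahn2005, §2.1 Lemma 2.4 (p. 10)] -/
private theorem multiMarker_fresh_eq' (w : Sym2 V → unitInterval) (s : V) (X : Set V) (T : Finset V)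
    (c : V → ℝ) (g : Set (Sym2 V) → ℝ) (ω : BondConfig V) :
    ((∫ η, g (openEdgeCluster (η \ {e | ∃ v ∈ e, ∃ x ∈ X, (openGraph ω).Reachable x v}) s) *
          (fun C : Set (Sym2 V) => ∑ u ∈ T, c u * (if (u = s ∨ ∃ e ∈ C, u ∈ e) then (1 : ℝ) else 0))
            (openEdgeCluster (η \ {e | ∃ v ∈ e, ∃ x ∈ X, (openGraph ω).Reachable x v}) s)
          ∂(prodBernoulli w)) -
      (∫ η, g (openEdgeCluster (η \ {e | ∃ v ∈ e, ∃ x ∈ X, (openGraph ω).Reachable x v}) s)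
          ∂(prodBernoulli w)) *
      (∫ η, (fun C : Set (Sym2 V) => ∑ u ∈ T, c u * (if (u = s ∨ ∃ e ∈ C, u ∈ e) then (1 : ℝ) else 0))
            (openEdgeCluster (η \ {e | ∃ v ∈ e, ∃ x ∈ X, (openGraph ω).Reachable x v}) s)
          ∂(prodBernoulli w))) =
    ∑ u ∈ T, c u * ((∫ η in (openConn s u : Set (BondConfig V)), g (openEdgeCluster η s)
            ∂(prodBernoulli fun e => if (∃ v ∈ e, ∃ x ∈ X, (openGraph ω).Reachable x v)
              then (0 : unitInterval) else w e)) -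
          (∫ η, g (openEdgeCluster η s)
            ∂(prodBernoulli fun e => if (∃ v ∈ e, ∃ x ∈ X, (openGraph ω).Reachable x v)
              then (0 : unitInterval) else w e)) *
          (prodBernoulli fun e => if (∃ v ∈ e, ∃ x ∈ X, (openGraph ω).Reachable x v)
              then (0 : unitInterval) else w e).real (openConn s u : Set (BondConfig V))) := by
  set wX : Sym2 V → unitInterval := fun e => if (∃ v ∈ e, ∃ x ∈ X, (openGraph ω).Reachable x v)
    then (0 : unitInterval) else w e with hwX
  set H : Set (Sym2 V) → ℝ := fun C => ∑ u ∈ T, c u * (if (u = s ∨ ∃ e ∈ C, u ∈ e) then (1 : ℝ) else 0)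
    with hH
  have hHω : ∀ η : BondConfig V, H (openEdgeCluster η s) =
      ∑ u ∈ T, c u * (openConn s u : Set (BondConfig V)).indicator 1 η := fun η => by
    simp only [hH, ite_mem_openEdgeCluster_eq_indicator]
  have h0 : ∀ e ∈ {e : Sym2 V | ∃ v ∈ e, ∃ x ∈ X, (openGraph ω).Reachable x v}, wX e = 0 :=
    fun e he => by simp only [hwX]; exact if_pos he
  have h1 : ∀ e ∉ {e : Sym2 V | ∃ v ∈ e, ∃ x ∈ X, (openGraph ω).Reachable x v}, wX e = w e :=
    fun e he => by simp only [hwX]; exact if_neg he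
  have splitU : ∀ G : BondConfig V → ℝ, ∫ η, G η * H (openEdgeCluster η s) ∂(prodBernoulli wX) =
      ∑ u ∈ T, c u * (∫ η in openConn s u, G η ∂(prodBernoulli wX)) := by
    intro G
    have e1 : (fun η => G η * H (openEdgeCluster η s)) = fun η =>
        ∑ u ∈ T, c u * (G η * (openConn s u : Set (BondConfig V)).indicator 1 η) := by
      funext η
      rw [hHω, Finset.mul_sum]
      exact Finset.sum_congr rfl fun u _ => by ring
    rw [e1, integral_finsetSum _ fun u _ => Integrable.of_finite]
    exact Finset.sum_congr rfl fun u _ => by rw [integral_const_mul, integral_mul_indicator_one'']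
  have massU : ∫ η, H (openEdgeCluster η s) ∂(prodBernoulli wX) =
      ∑ u ∈ T, c u * (prodBernoulli wX).real (openConn s u : Set (BondConfig V)) := by
    have h2 := splitU (fun _ => (1 : ℝ))
    simp only [one_mul] at h2
    rw [h2]
    exact Finset.sum_congr rfl fun u _ => by rw [setIntegral_const, smul_eq_mul, mul_one]
  rw [BHK2006.integral_comp_sdiff_prodBernoulli' w wX _ h0 h1
      (fun η => g (openEdgeCluster η s) * H (openEdgeCluster η s)),
    BHK2006.integral_comp_sdiff_prodBernoulli' w wX _ h0 h1 (fun η => g (openEdgeCluster η s)),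
    BHK2006.integral_comp_sdiff_prodBernoulli' w wX _ h0 h1 (fun η => H (openEdgeCluster η s)),
    splitU, massU, Finset.mul_sum, ← Finset.sum_sub_distrib]
  exact Finset.sum_congr rfl fun u _ => by ring

/-! ### Every CSH margin dominates its world-Harris floor -/

/-- **The quantitative conditioned slack hierarchy.**  Non-degenerate weights, owner `x ∉ Y`, observers `o ≠ v` off `insert x Y`, distinct
decoys `D` off `{x} ∪ Y ∪ {o, v}`, `f` monotone nonnegative on edge clusters, `S = {x} ∪ D`:
`μ(x↮Y) · ∫_{x↮Y} Cov_{w^ω}(f(𝒞_x), 1{o↔S} ∪ {o↔v}) dμ ≤ cshMargin w x Y D o v f`.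
[cite: VandenbergHaggstromKahn2005, §2.1 pp. 9–13, Thm. 1.4 (p. 7)] [cite: Gladkov2024, Thm. 3.2 (p. 4)] -/
theorem cshMargin_ge_worldHarris (w : Sym2 V → unitInterval) (hw : ∀ e, 0 < w e ∧ w e < 1) (x : V) (Y : Set V) (D : List V)
    (o v : V) (hxY : x ∉ Y) (hox : o ≠ x) (hvx : v ≠ x) (hoY : o ∉ Y) (hvY : v ∉ Y) (hov : o ≠ v)
    (hnd : D.Nodup) (hD : ∀ d ∈ D, d ≠ x ∧ d ∉ Y ∧ d ≠ o ∧ d ≠ v)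
    (f : Set (Sym2 V) → ℝ) (hf : Monotone f) (hf0 : ∀ C, 0 ≤ f C) :
    (prodBernoulli w).real {ω : BondConfig V | ∀ y ∈ Y, ¬ (openGraph ω).Reachable x y} *
        ∫ ω in {ω : BondConfig V | ∀ y ∈ Y, ¬ (openGraph ω).Reachable x y},
          ((∫ η in ((⋃ t ∈ insert x D.toFinset, openConn o t) ∪ openConn o v), f (openEdgeCluster η x)
              ∂(prodBernoulli fun e => if (∃ z ∈ e, ∃ y ∈ Y, (openGraph ω).Reachable y z) then (0 : unitInterval) else w e)) -
            (prodBernoulli fun e => if (∃ z ∈ e, ∃ y ∈ Y, (openGraph ω).Reachable y z) then (0 : unitInterval) else w e).real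
                ((⋃ t ∈ insert x D.toFinset, openConn o t) ∪ openConn o v) *
              (∫ η, f (openEdgeCluster η x)
                ∂(prodBernoulli fun e => if (∃ z ∈ e, ∃ y ∈ Y, (openGraph ω).Reachable y z) then (0 : unitInterval) else w e)))
          ∂(prodBernoulli w) ≤
      cshMargin w x Y D o v f := by
  set μ := prodBernoulli w with hμ
  set D₀ : Set (BondConfig V) := {ω : BondConfig V | ∀ y ∈ Y, ¬ (openGraph ω).Reachable x y} with hD₀def
  set w' : Sym2 V → ℝ := fun e => (w e : ℝ) with hw'
  have hw0 : ∀ e, 0 ≤ w' e := fun e => (w e).2.1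
  have hw1 : ∀ e, w' e ≤ 1 := fun e => (w e).2.2
  have hm : ∑ ω, weight w' ω = 1 := sum_weight_eq_one' w
  have hDm : ∀ ω, ω ∈ D₀ ↔ ∀ s' ∈ ({x} : Set V), ∀ t ∈ Y, ¬ (openGraph ω).Reachable s' t := mem_D_iff' x Y
  have hv : v ∉ insert x Y := by simp [hvx, hvY]
  have hdis : ∀ d ∈ D, d ∉ insert x Y ∧ d ≠ o ∧ d ≠ v := fun d hd =>
    ⟨by rw [mem_insert_iff, not_or]; exact ⟨(hD d hd).1, (hD d hd).2.1⟩, (hD d hd).2.2.1, (hD d hd).2.2.2⟩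
  set L := decoyList w (insert x Y) D with hL
  set p : ℝ := obsConst w o v (insert x Y ∪ {d | d ∈ D}) with hp
  -- the coefficients of the level form and the multi-marker test function `h = Σ_u Λ_u χ_u`
  set Λ : V → ℝ := fun u => cshMarg L p o v (Pi.single u 1) with hΛ
  set H : Set (Sym2 V) → ℝ := fun C => ∑ u ∈ Finset.univ, Λ u * (if (u = x ∨ ∃ e ∈ C, u ∈ e) then (1 : ℝ) else 0) with hH
  -- (i) the margin as BHK's `cov_D(g, h)`, for any edge functional
  have hmargin : ∀ g : Set (Sym2 V) → ℝ, cshMargin w x Y D o v g = BHK2006.covD w' {x} D₀ g H := by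
    intro g
    rw [covD_sum_eq w x Y g H, multiMarker_conclusion_eq' w x Y Finset.univ Λ g, cshMargin, ← hL, ← hp, cshMarg_eq_sum]
    refine Finset.sum_congr rfl fun u _ => ?_
    simp only [hΛ, CSH.covD]
  -- (ii) the exact one-step decomposition, and Theorem 1 for `𝒯f`
  have hdec := covD_eq_withinD_add w' hm {x} Y hDm f H
  have hmass : ∑ ω, weight w' ω * ind D₀ ω = μ.real D₀ := (real_D_eq_sum' w x Y).symm
  rw [hmass] at hdec
  have hTmono : Monotone (gibbsT w' {x} Y f) := gibbsT_mono hw0 hw1 {x} Y hf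
  have hCSH : CSHHolds w x Y D o v := cshHolds w hw x Y D o v hxY (by simp [hox, hoY]) hv hov hnd hdis
  have hT : 0 ≤ BHK2006.covD w' {x} D₀ (gibbsT w' {x} Y f) H := by
    rw [← hmargin]
    exact hCSH _ hTmono
  -- (iii) the within term is the `{x↮Y}`-integral of the margin of the world covariances
  have hwithin : withinD w' {x} Y D₀ f H = ∫ ω in D₀,
      cshMarg L p o v
        (fun u => (∫ η in (openConn x u : Set (BondConfig V)), f (openEdgeCluster η x)
              ∂(prodBernoulli fun e => if (∃ z ∈ e, ∃ y ∈ Y, (openGraph ω).Reachable y z) then (0 : unitInterval) else w e)) -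
            (∫ η, f (openEdgeCluster η x)
              ∂(prodBernoulli fun e => if (∃ z ∈ e, ∃ y ∈ Y, (openGraph ω).Reachable y z) then (0 : unitInterval) else w e)) *
            (prodBernoulli fun e => if (∃ z ∈ e, ∃ y ∈ Y, (openGraph ω).Reachable y z) then (0 : unitInterval) else w e).real (openConn x u : Set (BondConfig V))) ∂μ := by
    rw [withinD_sum_eq w x Y f H]
    refine setIntegral_congr_fun MeasurableSet.of_discrete fun ω _ => ?_
    rw [multiMarker_fresh_eq' w x Y Finset.univ Λ f ω, cshMarg_eq_sum]
  -- Lemma U (tree identity) + the lower levels of the hierarchy: within ≥ H-part at `S = {x} ∪ D`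
  have hIH : ∀ (pre : List V) (d : V) (ds' : List V), D = pre ++ d :: ds' →
      ∀ h : Set (Sym2 V) → ℝ, Monotone h → (∀ C, 0 ≤ h C) → 0 ≤ cshMargin w d (insert x Y ∪ {e | e ∈ pre}) ds' o v h := by
    intro pre d ds' hsplit h hh _
    have hdD : d ∈ D := by rw [hsplit]; exact List.mem_append_right pre List.mem_cons_self
    have hpreD : ∀ e ∈ pre, e ∈ D := fun e he => by rw [hsplit]; exact List.mem_append_left _ he
    have hds'D : ∀ e ∈ ds', e ∈ D := fun e he => by
      rw [hsplit]; exact List.mem_append_right pre (List.mem_cons_of_mem d he)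
    have hnd' : (pre ++ d :: ds').Nodup := hsplit ▸ hnd
    have hnd_ds' : ds'.Nodup := (List.nodup_cons.1 (List.nodup_append.1 hnd').2.1).2
    have hd_notin_ds' : d ∉ ds' := (List.nodup_cons.1 (List.nodup_append.1 hnd').2.1).1
    have hds'_notin_pre : ∀ e ∈ ds', e ∉ pre := fun e he hep =>
      (List.nodup_append.1 hnd').2.2 e hep e (List.mem_cons_of_mem d he) rfl
    set Y' : Set V := insert x Y ∪ {e | e ∈ pre} with hY'
    have hvY' : v ∉ insert d Y' := by
      rintro (h0 | h1 | h2)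
      · exact (hdis d hdD).2.2 h0.symm
      · exact hv h1
      · exact (hdis v (hpreD v h2)).2.2 rfl
    have hdis' : ∀ e ∈ ds', e ∉ insert d Y' ∧ e ≠ o ∧ e ≠ v := by
      intro e he
      refine ⟨?_, (hdis e (hds'D e he)).2.1, (hdis e (hds'D e he)).2.2⟩
      rintro (h0 | h1 | h2)
      · exact hd_notin_ds' (h0 ▸ he)
      · exact (hdis e (hds'D e he)).1 h1
      · exact hds'_notin_pre e he h2
    exact cshMargin_nonneg_of_lower_induction w hw ds' d Y' o v hvY' hnd_ds' hdis' h hh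
  have hU := within_unfold w hw x Y D o v hnd hD f p
  have hsub := subT_comb_nonneg w x Y D o v hf hIH D [] (by simp)
  have hS0 : ({x} ∪ {e | e ∈ ([] : List V)} : Set V) = {x} := by ext u; simp
  rw [hS0, ← hp] at hsub
  have hHPle0 := (le_add_of_nonneg_right hsub).trans_eq hU.symm
  have hHPle : ∫ ω in {ω : BondConfig V | ∀ y ∈ Y, ¬ (openGraph ω).Reachable x y},
        (((∫ η in (⋃ t ∈ insert x D.toFinset, openConn o t), f (openEdgeCluster η x)
              ∂(prodBernoulli fun e => if (∃ z ∈ e, ∃ y ∈ Y, (openGraph ω).Reachable y z) then (0 : unitInterval) else w e)) -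
            (prodBernoulli fun e => if (∃ z ∈ e, ∃ y ∈ Y, (openGraph ω).Reachable y z) then (0 : unitInterval) else w e).real
                (⋃ t ∈ insert x D.toFinset, openConn o t) *
              (∫ η, f (openEdgeCluster η x)
                ∂(prodBernoulli fun e => if (∃ z ∈ e, ∃ y ∈ Y, (openGraph ω).Reachable y z) then (0 : unitInterval) else w e))) -
          p * ((∫ η in (⋃ t ∈ insert x D.toFinset, openConn v t), f (openEdgeCluster η x)
              ∂(prodBernoulli fun e => if (∃ z ∈ e, ∃ y ∈ Y, (openGraph ω).Reachable y z) then (0 : unitInterval) else w e)) -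
            (prodBernoulli fun e => if (∃ z ∈ e, ∃ y ∈ Y, (openGraph ω).Reachable y z) then (0 : unitInterval) else w e).real
                (⋃ t ∈ insert x D.toFinset, openConn v t) *
              (∫ η, f (openEdgeCluster η x)
                ∂(prodBernoulli fun e => if (∃ z ∈ e, ∃ y ∈ Y, (openGraph ω).Reachable y z) then (0 : unitInterval) else w e))))
        ∂μ ≤ withinD w' {x} Y D₀ f H := by
    rw [hwithin]
    convert hHPle0 using 20
  -- Lemma H, quantitative (lane): the H-part dominates the world-Harris integral
  have hvS : v ∉ insert x D.toFinset := by
    rw [Finset.mem_insert, List.mem_toFinset, not_or]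
    exact ⟨hvx, fun h => (hD v h).2.2.2 rfl⟩
  have hS : ((↑(insert x D.toFinset) : Set V) ∪ Y) = insert x Y ∪ {d | d ∈ D} := by
    ext u
    simp only [Finset.coe_insert, mem_union, mem_insert_iff, Finset.mem_coe, List.mem_toFinset, mem_setOf_eq]
    tauto
  have key := worldHarris_le_hpart w hw x Y (insert x D.toFinset) (Finset.mem_insert_self x _) o v hvS hvY f hf hf0
  rw [hS, ← hp] at key
  -- assemble
  rw [hmargin f, hdec]
  have hDn : 0 ≤ μ.real D₀ := measureReal_nonneg
  refine le_trans (mul_le_mul_of_nonneg_left (le_trans ?_ hHPle) hDn) (by linarith [hT])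
  convert key using 20

/-- **Level `D = []`** (lane row M2-R7): `μ(x↮Y) · ∫_{x↮Y} Cov_{w^ω}(f(𝒞_x), 1{o↔x} ∪ {o↔v}) dμ ≤ cshMargin w x Y [] o v f`.
[cite: VandenbergHaggstromKahn2005, §2.1 pp. 9–13, Thm. 1.4 (p. 7)] [cite: Gladkov2024, Thm. 3.2 (p. 4)] -/
theorem cshMargin_nil_ge_worldHarris (w : Sym2 V → unitInterval) (hw : ∀ e, 0 < w e ∧ w e < 1) (x : V) (Y : Set V) (o v : V)
    (hxY : x ∉ Y) (hox : o ≠ x) (hvx : v ≠ x) (hoY : o ∉ Y) (hvY : v ∉ Y) (hov : o ≠ v)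
    (f : Set (Sym2 V) → ℝ) (hf : Monotone f) (hf0 : ∀ C, 0 ≤ f C) :
    (prodBernoulli w).real {ω : BondConfig V | ∀ y ∈ Y, ¬ (openGraph ω).Reachable x y} *
        ∫ ω in {ω : BondConfig V | ∀ y ∈ Y, ¬ (openGraph ω).Reachable x y},
          ((∫ η in ((⋃ t ∈ ({x} : Finset V), openConn o t) ∪ openConn o v), f (openEdgeCluster η x)
              ∂(prodBernoulli fun e => if (∃ z ∈ e, ∃ y ∈ Y, (openGraph ω).Reachable y z) then (0 : unitInterval) else w e)) -
            (prodBernoulli fun e => if (∃ z ∈ e, ∃ y ∈ Y, (openGraph ω).Reachable y z) then (0 : unitInterval) else w e).real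
                ((⋃ t ∈ ({x} : Finset V), openConn o t) ∪ openConn o v) *
              (∫ η, f (openEdgeCluster η x)
                ∂(prodBernoulli fun e => if (∃ z ∈ e, ∃ y ∈ Y, (openGraph ω).Reachable y z) then (0 : unitInterval) else w e)))
          ∂(prodBernoulli w) ≤
      cshMargin w x Y [] o v f := by
  have h := cshMargin_ge_worldHarris w hw x Y [] o v hxY hox hvx hoY hvY hov List.nodup_nil (fun d hd => by simp at hd) f hf hf0
  rw [show insert x (([] : List V).toFinset) = ({x} : Finset V) by simp] at h
  exact h

end Summit.CriticalPhenomena.PercolationContinuityZ3.Theorems.CSH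

end
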